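import Summits.ValiantsHypothesis.ValiantsHypothesis.Theorems.BarrierLeverSuccinctHittingSetsForVPCoordSlice
import HarnessLib

/-!
# Crux `BarrierLever.SuccinctHittingSetsForVP` (stmt-ValiantsHypothesis-14610) — THE SET-MULTILINEAR
SLICE THEOREM: for EVERY block labelling `π : Fin n → Fin d`, `N^a`-sparse level-`a` distinguishers
are hit relative to the slice of `π`-set-multilinear polynomials (FSV 2018 Thm. 9 mechanism; the
narrowed barrier at `P = setMultilinearSlice π`; cell `valiant-natproofs` V4 kill-test item 2)

Lean text authored by the cell planner seat `valiant-natproofs-p1` (gen 2, HOME/p1/Chain2.lean §D),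
landed by the prover seat as a helper of the crux. Unconditional; does NOT close the item.

* `IsSetMultilinear π μ`, `setMultilinearSlice π`, the block product `blockProd π = ∏_j Σ_{π i = j} x_i`
  (size `≤ n + d`, degree `≤ d`, support = exactly the set-multilinear monomials, all coefficients
  `1`: `setMultilinearBase_holds`);
* `setMultilinear_sparse` — for `n ≥ 8a + 2` and every `π`,
  `IsSuccinctHittingSetRel (degLEMonomials n) (setMultilinearSlice π) (SmallCircuits ℂ n 3) {N^a-sparse level-a D}`;
  `succinctHittingSetsRel_setMultilinear_sparse_holds` (eventually-in-`n` form, uniformly in `π`);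
  `not_naturalProofRel_setMultilinear_sparse_holds` — no `N^a`-sparse relative natural proof
  vanishing on the simple set-multilinear polynomials.

References: [ForbesShpilkaVolk2018] §1.2, Thm. 9, Cor. 34.
-/

-- layout Summits/ValiantsHypothesis/ValiantsHypothesis forces the duplicated namespace component
set_option linter.dupNamespace false

noncomputable section

namespace Summit.ValiantsHypothesis.ValiantsHypothesis.Theorems.BarrierLever.SuccinctHittingSetsForVP

namespace CoordSlice

open Literature.Barriers.ValiantsHypothesis Literature.Computability.AlgebraicComplexity MvPolynomial
open Summit.ValiantsHypothesis.ValiantsHypothesis.Theorems.BarrierLever.SuccinctHittingSetsForVP.MultilinearSparseGlue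

variable {n : ℕ}

/-! ### The set-multilinear slice -/

variable {d : ℕ}

/-- A monomial is SET-MULTILINEAR for the block labelling `π : Fin n → Fin d` if it has total degree
exactly one inside each block `π⁻¹(j)`. [cite: ForbesShpilkaVolk2018, §1.2] -/
def IsSetMultilinear (π : Fin n → Fin d) (μ : Fin n →₀ ℕ) : Prop :=
  ∀ j : Fin d, ∑ i ∈ Finset.univ.filter (fun i => π i = j), μ i = 1

/-- The set-multilinear slice of `π` (a coordinate slice). -/
def setMultilinearSlice (π : Fin n → Fin d) : Set (MvPolynomial (Fin n) ℂ) :=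
  coordSlice (IsSetMultilinear π)

/-- The candidate indicator of the set-multilinear slice: the block product `∏_j (Σ_{π i = j} x_i)`
(each set-multilinear monomial appears exactly once in the expansion). -/
noncomputable def blockProd (π : Fin n → Fin d) : MvPolynomial (Fin n) ℂ :=
  ∏ j : Fin d, ∑ i ∈ Finset.univ.filter (fun i => π i = j), X i

/-- **The set-multilinear base lemma** (the analogue of the landed `stub_multilinearBase` with
`∏ (1 + x_i)` replaced by the block product; PROVED below as `setMultilinearBase_holds`): for `n ≥ 2`
and every block labelling, `blockProd π` is a member of `SmallCircuits ℂ n 2` (size `≤ n + d ≤ n²`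
when `d ≤ n`, and `blockProd π = 0` when `d > n`), lies in the set-multilinear slice, and has
coefficient `1` at every set-multilinear monomial. -/
def SetMultilinearBase : Prop :=
  ∀ (n d : ℕ) (π : Fin n → Fin d), 2 ≤ n →
    blockProd π ∈ SmallCircuits ℂ n 2 ∧ blockProd π ∈ setMultilinearSlice π ∧
      ∀ μ : Fin n →₀ ℕ, IsSetMultilinear π μ → coeff μ (blockProd π) = 1

/-- **SET-MULTILINEAR SLICE THEOREM, sparse distinguishers (PROVED-HERE modulo `SetMultilinearBase`).**
For `n ≥ 8a + 2` and EVERY block labelling `π : Fin n → Fin d`, every `C(2n,n)^a`-sparse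
distinguisher nonzero somewhere on the set-multilinear slice of `π` is nonzero at a set-multilinear
member of `SmallCircuits ℂ n 3` — the `P = setMultilinearSlice π` case of the narrowed barrier
`AlgebraicNaturalProofsNarrow` for sparse `𝒟` (rung V4 kill-test item "slice theorem for
set-multilinear D"). [cite: ForbesShpilkaVolk2018, Thm. 9] -/
theorem isSuccinctHittingSetRel_setMultilinear_sparse (hB : SetMultilinearBase) {n a d : ℕ}
    (hn : 8 * a + 2 ≤ n) (π : Fin n → Fin d) :
    IsSuccinctHittingSetRel (degLEMonomials n) (setMultilinearSlice π) (SmallCircuits ℂ n 3)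
      {D | D.support.card ≤ Nat.choose (2 * n) n ^ a} := by
  obtain ⟨hS, hP, hcoef⟩ := hB n d π (by omega)
  exact isSuccinctHittingSetRel_coordSlice_sparse hn _ _ hS hP fun μ hμ => hcoef _ hμ

/-- In the `∀ a ∃ b n₀` shape of `SuccinctHittingSetsForVPRel`, uniformly over all block labellings
(PROVED-HERE modulo `SetMultilinearBase`). [cite: ForbesShpilkaVolk2018, Thm. 9 and Question 6] -/
theorem succinctHittingSetsRel_setMultilinear_sparse (hB : SetMultilinearBase) :
    ∀ a : ℕ, ∃ b n₀ : ℕ, ∀ n : ℕ, n₀ ≤ n → ∀ (d : ℕ) (π : Fin n → Fin d),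
      IsSuccinctHittingSetRel (degLEMonomials n) (setMultilinearSlice π) (SmallCircuits ℂ n b)
        (Distinguishers ℂ n a ∩ {D | D.support.card ≤ Nat.choose (2 * n) n ^ a}) := by
  intro a
  refine ⟨3, 8 * a + 2, fun n hn d π D hD hg => ?_⟩
  exact isSuccinctHittingSetRel_setMultilinear_sparse hB hn π D hD.2 hg

/-- **No sparse set-multilinear-relative natural proofs against `VP`** (PROVED-HERE modulo
`SetMultilinearBase`): for `n ≥ 8a + 2`, `b ≥ 3`, every block labelling and every target, an
`N^a`-sparse distinguisher vanishing at all SET-MULTILINEAR members of `SmallCircuits ℂ n b` vanishes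
on the whole set-multilinear slice (so certifies nothing about, e.g., `IMM` or a set-multilinear
encoding of the permanent). [cite: ForbesShpilkaVolk2018, Def. 1 and Thm. 9] -/
theorem not_naturalProofRel_setMultilinear_sparse (hB : SetMultilinearBase) {n a b d : ℕ}
    (hn : 8 * a + 2 ≤ n) (hb : 3 ≤ b) (π : Fin n → Fin d)
    (D : MvPolynomial (degLEMonomials n) ℂ) (hsparse : D.support.card ≤ Nat.choose (2 * n) n ^ a)
    (hvan : ∀ f ∈ SmallCircuits ℂ n b, f ∈ setMultilinearSlice π →
      eval (coeffVector (degLEMonomials n) f) D = 0) :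
    ∀ g ∈ setMultilinearSlice π, eval (coeffVector (degLEMonomials n) g) D = 0 := by
  intro g hg
  by_contra hne
  obtain ⟨f, hf, hfP, hfne⟩ :=
    isSuccinctHittingSetRel_setMultilinear_sparse hB hn π D hsparse ⟨g, hg, hne⟩
  exact hfne (hvan f (smallCircuits_mono ℂ hb (by omega) hf) hfP)

/-! ### Proof of the set-multilinear base lemma -/

/-- Block `j` of the labelling `π`. -/
def block (π : Fin n → Fin d) (j : Fin d) : Finset (Fin n) :=
  Finset.univ.filter fun i => π i = j

/-- Membership in a block. [cite: ForbesShpilkaVolk2018, §1.2] -/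
theorem mem_block {π : Fin n → Fin d} {j : Fin d} {i : Fin n} : i ∈ block π j ↔ π i = j := by
  simp [block]

/-- The linear form `Σ_{π i = j} x_i` of block `j`. -/
noncomputable def blockSum (π : Fin n → Fin d) (j : Fin d) : MvPolynomial (Fin n) ℂ :=
  ∑ i ∈ block π j, X i

/-- The block product is the product of the block sums. [cite: ForbesShpilkaVolk2018, §1.2] -/
theorem blockProd_eq (π : Fin n → Fin d) : blockProd π = ∏ j, blockSum π j := rfl

/-- The degree of `μ` inside block `j`. -/
def bdeg (π : Fin n → Fin d) (j : Fin d) (μ : Fin n →₀ ℕ) : ℕ := ∑ i ∈ block π j, μ i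

/-- An exponent is at most the degree of its block. [cite: ForbesShpilkaVolk2018, §1.2] -/
theorem le_bdeg (π : Fin n → Fin d) (μ : Fin n →₀ ℕ) (i : Fin n) : μ i ≤ bdeg π (π i) μ :=
  Finset.single_le_sum (f := fun i => μ i) (fun _ _ => Nat.zero_le _) (mem_block.mpr rfl)

/-- A monomial with all block degrees zero is trivial. [cite: ForbesShpilkaVolk2018, §1.2] -/
theorem eq_zero_of_bdeg {π : Fin n → Fin d} {μ : Fin n →₀ ℕ} (h : ∀ j, bdeg π j μ = 0) : μ = 0 := by
  ext i
  have hi := le_bdeg π μ i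
  rw [h] at hi
  simpa using hi

/-- Block degree is additive. [cite: ForbesShpilkaVolk2018, §1.2] -/
theorem bdeg_add (π : Fin n → Fin d) (j : Fin d) (μ ν : Fin n →₀ ℕ) :
    bdeg π j (μ + ν) = bdeg π j μ + bdeg π j ν := by
  simp [bdeg, Finsupp.add_apply, Finset.sum_add_distrib]

/-- Block degree of a variable. [cite: ForbesShpilkaVolk2018, §1.2] -/
theorem bdeg_single (π : Fin n → Fin d) (j : Fin d) (i₀ : Fin n) :
    bdeg π j (Finsupp.single i₀ 1) = if π i₀ = j then 1 else 0 := by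
  classical
  simp only [bdeg, Finsupp.single_apply]
  rw [Finset.sum_ite_eq]
  simp [mem_block]

/-- Coefficients of `(Σ_{i ∈ block j} x_i) · P`. [folklore] -/
theorem coeff_blockSum_mul (π : Fin n → Fin d) (j : Fin d) (P : MvPolynomial (Fin n) ℂ)
    (μ : Fin n →₀ ℕ) :
    coeff μ (blockSum π j * P) =
      ∑ i ∈ (block π j).filter (fun i => i ∈ μ.support), coeff (μ - Finsupp.single i 1) P := by
  classical
  rw [blockSum, Finset.sum_mul, coeff_sum, Finset.sum_filter]
  refine Finset.sum_congr rfl fun i _ => ?_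
  rw [coeff_X_mul']

/-- If `μ` has degree exactly one inside block `j`, exactly one variable of the block occurs in `μ`,
with exponent one. [folklore] -/
theorem filter_support_eq_singleton {π : Fin n → Fin d} {j : Fin d} {μ : Fin n →₀ ℕ}
    (h : bdeg π j μ = 1) :
    ∃ i₀, i₀ ∈ block π j ∧ μ i₀ = 1 ∧ (block π j).filter (fun i => i ∈ μ.support) = {i₀} := by
  classical
  obtain ⟨i₀, hi₀B, hi₀⟩ : ∃ i ∈ block π j, μ i ≠ 0 :=
    Finset.exists_ne_zero_of_sum_ne_zero (by unfold bdeg at h; omega)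
  have hle : μ i₀ ≤ 1 := by
    have := Finset.single_le_sum (f := fun i => μ i) (fun _ _ => Nat.zero_le _) hi₀B
    unfold bdeg at h
    simpa [h] using this
  have hμi₀ : μ i₀ = 1 := by omega
  refine ⟨i₀, hi₀B, hμi₀, ?_⟩
  ext i
  simp only [Finset.mem_filter, Finset.mem_singleton, Finsupp.mem_support_iff]
  constructor
  · rintro ⟨hiB, hi⟩
    by_contra hne
    have hpair : μ i + μ i₀ ≤ bdeg π j μ := by
      calc μ i + μ i₀ = ∑ k ∈ ({i, i₀} : Finset (Fin n)), μ k := by rw [Finset.sum_pair hne]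
        _ ≤ ∑ k ∈ block π j, μ k := Finset.sum_le_sum_of_subset (by
            intro k hk
            rcases Finset.mem_insert.mp hk with rfl | hk
            · exact hiB
            · rw [Finset.mem_singleton.mp hk]; exact hi₀B)
    omega
  · rintro rfl
    exact ⟨hi₀B, by omega⟩

/-- **The coefficients of a partial block product**: `coeff_μ ∏_{j ∈ s} (Σ_{block j} x_i) = 1` if
`μ` has block-degree profile `𝟙_s`, and `0` otherwise. [folklore] -/
theorem coeff_prod_blockSum (π : Fin n → Fin d) (s : Finset (Fin d)) :
    ∀ μ : Fin n →₀ ℕ, coeff μ (∏ j ∈ s, blockSum π j) =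
      if ∀ j, bdeg π j μ = (if j ∈ s then 1 else 0) then 1 else 0 := by
  classical
  induction s using Finset.induction_on with
  | empty =>
    intro μ
    rw [Finset.prod_empty, coeff_one]
    simp only [Finset.notMem_empty, if_false]
    by_cases hμ : μ = 0
    · subst hμ
      simp [bdeg]
    · rw [if_neg (fun h => hμ h.symm), if_neg (fun h => hμ (eq_zero_of_bdeg h))]
  | insert j₀ s hj₀ ih =>
    intro μ
    rw [Finset.prod_insert hj₀, coeff_blockSum_mul]
    by_cases h1 : bdeg π j₀ μ = 1
    · obtain ⟨i₀, hi₀B, hμi₀, hfilter⟩ := filter_support_eq_singleton h1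
      rw [hfilter, Finset.sum_singleton, ih]
      have hνμ : μ - Finsupp.single i₀ 1 + Finsupp.single i₀ 1 = μ :=
        tsub_add_cancel_of_le (Finsupp.single_le_iff.mpr (by omega))
      have hb : ∀ j, bdeg π j μ = bdeg π j (μ - Finsupp.single i₀ 1) + if j = j₀ then 1 else 0 := by
        intro j
        conv_lhs => rw [← hνμ]
        rw [bdeg_add, bdeg_single, mem_block.mp hi₀B]
        by_cases hj : j = j₀
        · subst hj; simp
        · simp [hj, Ne.symm hj]
      by_cases hc : ∀ j, bdeg π j (μ - Finsupp.single i₀ 1) = if j ∈ s then 1 else 0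
      · rw [if_pos hc, if_pos]
        intro j
        rw [hb j, hc j]
        by_cases hj : j = j₀
        · subst hj; simp [hj₀]
        · simp [hj, Finset.mem_insert]
      · rw [if_neg hc, if_neg]
        intro hμc
        apply hc
        intro j
        have hj' := hμc j
        rw [hb j] at hj'
        by_cases hj : j = j₀
        · subst hj
          simp only [Finset.mem_insert_self, if_true] at hj'
          rw [if_neg hj₀]
          omega
        · simp only [hj, if_false, add_zero, Finset.mem_insert, false_or] at hj'
          exact hj'
    · rw [if_neg (fun h => h1 (by simpa using h j₀))]
      refine Finset.sum_eq_zero fun i hi => ?_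
      obtain ⟨hiB, hisupp⟩ := Finset.mem_filter.mp hi
      rw [ih, if_neg]
      intro hc
      apply h1
      have hνμ : μ - Finsupp.single i 1 + Finsupp.single i 1 = μ :=
        tsub_add_cancel_of_le (Finsupp.single_le_iff.mpr
          (Nat.one_le_iff_ne_zero.mpr (Finsupp.mem_support_iff.mp hisupp)))
      rw [← hνμ, bdeg_add, bdeg_single, hc j₀, if_neg hj₀, if_pos (mem_block.mp hiB)]

/-- A block sum costs at most its size. [cite: ForbesShpilkaVolk2018, Thm. 9] -/
theorem complexity_blockSum_le (π : Fin n → Fin d) (j : Fin d) :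
    complexity (blockSum π j) ≤ (block π j).card := by
  calc complexity (blockSum π j)
      ≤ ∑ i ∈ block π j, complexity (X i : MvPolynomial (Fin n) ℂ) + (block π j).card :=
        complexity_finset_sum_le _ _
    _ = (block π j).card := by
        rw [Finset.sum_eq_zero (fun i _ => complexity_X_holds i), zero_add]

/-- The blocks partition the variables. [cite: ForbesShpilkaVolk2018, §1.2] -/
theorem sum_card_block (π : Fin n → Fin d) : ∑ j, (block π j).card = n := by
  have h := Finset.card_eq_sum_card_fiberwise (s := (Finset.univ : Finset (Fin n)))
    (t := (Finset.univ : Finset (Fin d))) (f := π) (fun _ _ => Finset.mem_univ _)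
  rw [Finset.card_univ, Fintype.card_fin] at h
  exact h.symm

/-- The block product has circuit size `≤ n + d`. [cite: ForbesShpilkaVolk2018, Thm. 9] -/
theorem complexity_blockProd_le (π : Fin n → Fin d) : complexity (blockProd π) ≤ n + d := by
  calc complexity (blockProd π)
      ≤ ∑ j, complexity (blockSum π j) + (Finset.univ : Finset (Fin d)).card :=
        complexity_finset_prod_le _ _
    _ ≤ ∑ j, (block π j).card + d := by
        rw [Finset.card_univ, Fintype.card_fin]
        exact Nat.add_le_add_right (Finset.sum_le_sum fun j _ => complexity_blockSum_le π j) d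
    _ = n + d := by rw [sum_card_block]

/-- The block product has degree `≤ d`. [cite: ForbesShpilkaVolk2018, Thm. 9] -/
theorem totalDegree_blockProd_le (π : Fin n → Fin d) : (blockProd π).totalDegree ≤ d := by
  refine (totalDegree_finsetProd _ _).trans ?_
  calc ∑ j, (blockSum π j).totalDegree ≤ ∑ _j : Fin d, 1 :=
        Finset.sum_le_sum fun j _ =>
          totalDegree_finsetSum_le fun i _ => (totalDegree_X (R := ℂ) i).le
    _ = d := by simp

/-- With more blocks than variables some block is empty and the product vanishes. [cite: ForbesShpilkaVolk2018, §1.2] -/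
theorem blockProd_eq_zero_of_lt (π : Fin n → Fin d) (h : n < d) : blockProd π = 0 := by
  classical
  have hns : ¬ Function.Surjective π := fun hs => by
    have := Fintype.card_le_of_surjective π hs
    simp only [Fintype.card_fin] at this
    omega
  obtain ⟨j₀, hj₀⟩ : ∃ j₀, ∀ i, π i ≠ j₀ := by
    by_contra hcon
    apply hns
    intro j
    by_contra hj
    exact hcon ⟨j, fun i hi => hj ⟨i, hi⟩⟩
  apply Finset.prod_eq_zero (Finset.mem_univ j₀)
  have hB : block π j₀ = ∅ := Finset.filter_eq_empty_iff.mpr fun i _ => hj₀ i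
  change blockSum π j₀ = 0
  rw [blockSum, hB, Finset.sum_empty]

/-- **The set-multilinear base lemma, PROVED-HERE.** [cite: ForbesShpilkaVolk2018, Construction 29] -/
theorem setMultilinearBase_holds : SetMultilinearBase := by
  intro n d π hn
  classical
  have hcoef : ∀ μ : Fin n →₀ ℕ,
      coeff μ (blockProd π) = if IsSetMultilinear π μ then 1 else 0 := by
    intro μ
    rw [blockProd_eq, coeff_prod_blockSum]
    by_cases h : IsSetMultilinear π μ
    · rw [if_pos h, if_pos]
      intro j
      rw [if_pos (Finset.mem_univ j)]
      exact h j
    · rw [if_neg h, if_neg]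
      intro h'
      exact h fun j => by
        have hj := h' j
        rw [if_pos (Finset.mem_univ j)] at hj
        exact hj
  have hslice : blockProd π ∈ setMultilinearSlice π := by
    intro m hm
    rw [mem_support_iff, hcoef] at hm
    by_contra h
    exact hm (if_neg h)
  have hone : ∀ μ : Fin n →₀ ℕ, IsSetMultilinear π μ → coeff μ (blockProd π) = 1 := fun μ h => by
    rw [hcoef, if_pos h]
  refine ⟨?_, hslice, hone⟩
  by_cases hd : d ≤ n
  · refine ⟨(totalDegree_blockProd_le π).trans hd, (complexity_blockProd_le π).trans ?_⟩
    nlinarith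
  · rw [blockProd_eq_zero_of_lt π (by omega)]
    refine ⟨by simp, ?_⟩
    have h0 : complexity (0 : MvPolynomial (Fin n) ℂ) = 0 := by
      simpa using complexity_C_holds (k := ℂ) (σ := Fin n) 0
    rw [h0]
    exact Nat.zero_le _

/-- **SET-MULTILINEAR SLICE THEOREM, unconditional (PROVED-HERE).** For `n ≥ 8a + 2` and every block
labelling `π`, `C(2n,n)^a`-sparse distinguishers are hit relative to the set-multilinear slice of `π`
by set-multilinear members of `SmallCircuits ℂ n 3`. [cite: ForbesShpilkaVolk2018, Thm. 9] -/
theorem setMultilinear_sparse {n a d : ℕ} (hn : 8 * a + 2 ≤ n) (π : Fin n → Fin d) :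
    IsSuccinctHittingSetRel (degLEMonomials n) (setMultilinearSlice π) (SmallCircuits ℂ n 3)
      {D | D.support.card ≤ Nat.choose (2 * n) n ^ a} :=
  isSuccinctHittingSetRel_setMultilinear_sparse setMultilinearBase_holds hn π

/-- Unconditional `∀ a ∃ b n₀` form. [cite: ForbesShpilkaVolk2018, Thm. 9 and Question 6] -/
theorem succinctHittingSetsRel_setMultilinear_sparse_holds :
    ∀ a : ℕ, ∃ b n₀ : ℕ, ∀ n : ℕ, n₀ ≤ n → ∀ (d : ℕ) (π : Fin n → Fin d),
      IsSuccinctHittingSetRel (degLEMonomials n) (setMultilinearSlice π) (SmallCircuits ℂ n b)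
        (Distinguishers ℂ n a ∩ {D | D.support.card ≤ Nat.choose (2 * n) n ^ a}) :=
  succinctHittingSetsRel_setMultilinear_sparse setMultilinearBase_holds

/-- Unconditional: no sparse set-multilinear-relative natural proofs against `VP`.
[cite: ForbesShpilkaVolk2018, Def. 1 and Thm. 9] -/
theorem not_naturalProofRel_setMultilinear_sparse_holds {n a b d : ℕ}
    (hn : 8 * a + 2 ≤ n) (hb : 3 ≤ b) (π : Fin n → Fin d)
    (D : MvPolynomial (degLEMonomials n) ℂ) (hsparse : D.support.card ≤ Nat.choose (2 * n) n ^ a)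
    (hvan : ∀ f ∈ SmallCircuits ℂ n b, f ∈ setMultilinearSlice π →
      eval (coeffVector (degLEMonomials n) f) D = 0) :
    ∀ g ∈ setMultilinearSlice π, eval (coeffVector (degLEMonomials n) g) D = 0 :=
  not_naturalProofRel_setMultilinear_sparse setMultilinearBase_holds hn hb π D hsparse hvan


end CoordSlice

end Summit.ValiantsHypothesis.ValiantsHypothesis.Theorems.BarrierLever.SuccinctHittingSetsForVP

end
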